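import Mathlib
import Summits.PneNP.PneNP.Theorems.ConvexRankGatesConvexGateBlindCatchTwo

/-!
# PneNP / ConvexRankGates — `ConvexGateBlind`: negative mass inside a `k`-set and the entry bound `O(k²/m)`

Helpers (`--supports stmt-PneNP-10680`), COLUMN-SPACE line (prover seat 2, session 16): the realisation lemma
`…CondPositivity.negMass_hub_le` applied with the hub set EQUAL TO A `k`-SET `Q₀` (`#H = k`, `X = k(k−2)/(m−k−1) ≤ 1/2` once
`2k² ≤ m`) bounds the negative mass inside any `k`-set of a `k`-clique-non-negative weighting:

* `negMass_kset_le` — `½∑_{Q₀×Q₀} max(−V,0) ≤ (2k(k−2)/(m−k−1)) · ½∑∑V` (matrix form);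
* `entry_le_negMass_of_tight`, `abs_le_of_minimal` — in a MINIMAL clique-non-negative edge weighting `v` (every positive edge lies
  in a tight `k`-set) with total `W`, every entry satisfies `|v(e)| ≤ (2k(k−2)/(m−k−1))·W = O(k²/m)·W`
  (stub `minimal_entry_bound`).

This replaces the entry bound `β = C(k,2)(k−2)/(m−k) = Θ(k³/m)` of `…NegCoverCatch` / `…CatchTwo` (tightness × the
single-entry bound) by `β' = Θ(k²/m)`, so that the second term `exp(−Ω(1/√β))` of the catch bounds becomes
`exp(−Ω(√m/k))` — superpolynomial for every `δ < 1/2`. [new]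
-/

set_option linter.dupNamespace false

namespace Summit.PneNP.PneNP.Theorems

open Finset Real Literature.Computability.Complexity
open Summit.PneNP.PneNP.Cruxes.ConvexGateBlind.StrictRankConicCover (Edge)

noncomputable section

variable {m : ℕ}

/-! ## Negative mass inside a `k`-set (matrix form) -/

/-- **Negative mass inside a `k`-set.** For `V` symmetric, zero-diagonal and `k`-clique-non-negative (`4 ≤ k`, `2k² ≤ m`)
and any `k`-set `Q₀`: `½∑_{a,b ∈ Q₀} max(−V a b, 0) ≤ (2k(k−2)/(m−k−1)) · ½∑∑ V`. [new] -/
theorem negMass_kset_le {k : ℕ} (hk : 4 ≤ k) (hm : 2 * k ^ 2 ≤ m) (V : Fin m → Fin m → ℝ) (hV : ∀ x y, V x y = V y x)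
    (hV0 : ∀ x, V x x = 0) (hvalid : ∀ Q ∈ (Finset.univ : Finset (Fin m)).powersetCard k, 0 ≤ ∑ x ∈ Q, ∑ y ∈ Q, V x y)
    (Q₀ : Finset (Fin m)) (hQ₀ : Q₀.card = k) :
    (∑ a ∈ Q₀, ∑ b ∈ Q₀, max (-V a b) 0) / 2 ≤
      (2 * (k : ℝ) * ((k : ℝ) - 2) / ((m : ℝ) - k - 1)) * ((∑ x, ∑ y, V x y) / 2) := by
  classical
  have hkR : (4 : ℝ) ≤ k := by exact_mod_cast hk
  have hmR : 2 * (k : ℝ) ^ 2 ≤ m := by exact_mod_cast hm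
  have hkk : k ≤ k ^ 2 := by nlinarith
  have hmk : k + k ≤ m := by nlinarith
  -- sizes
  have hHc : (Q₀ᶜ).card = m - k := by rw [Finset.card_compl, Fintype.card_fin, hQ₀]
  have hS : k ≤ (Q₀ᶜ).card := by rw [hHc]; omega
  have hHcR : ((Q₀ᶜ).card : ℝ) = (m : ℝ) - k := by
    rw [hHc, Nat.cast_sub (by omega)]
  set X : ℝ := ((k : ℝ) - 2) * Q₀.card / (((Q₀ᶜ).card : ℝ) - 1) with hXdef
  have hden : (0 : ℝ) < (m : ℝ) - k - 1 := by nlinarith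
  have hXeq : X = (k : ℝ) * ((k : ℝ) - 2) / ((m : ℝ) - k - 1) := by
    rw [hXdef, hQ₀, hHcR]; ring
  have hX0 : 0 ≤ X := by rw [hXeq]; exact div_nonneg (by nlinarith) hden.le
  have hXhalf : X ≤ 1 / 2 := by
    rw [hXeq, div_le_iff₀ hden]; nlinarith
  have hneg := negMass_hub_le V hV hV0 hk hvalid Q₀ hS hXhalf
  rw [← hXdef] at hneg
  -- total mass is non-negative
  have hW0 : 0 ≤ (∑ x, ∑ y, V x y) / 2 := by
    have h0 := sum_valid_powersetCard V hV0 (by omega) hvalid (Finset.univ : Finset (Fin m))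
    have hC : (0 : ℝ) < (Nat.choose ((Finset.univ : Finset (Fin m)).card - 2) (k - 2) : ℝ) := by
      rw [Finset.card_univ, Fintype.card_fin]
      exact_mod_cast Nat.choose_pos (by omega)
    have := nonneg_of_mul_nonneg_right h0 hC
    linarith
  -- mass inside `Q₀` is at least `−negH`
  set N : ℝ := (∑ a ∈ Q₀, ∑ b ∈ Q₀, max (-V a b) 0) / 2 with hN
  have hmassH : -N ≤ (∑ a ∈ Q₀, ∑ b ∈ Q₀, V a b) / 2 := by
    rw [hN, ← neg_div]
    refine div_le_div_of_nonneg_right ?_ (by norm_num)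
    rw [← Finset.sum_neg_distrib]
    refine Finset.sum_le_sum fun a _ => ?_
    rw [← Finset.sum_neg_distrib]
    exact Finset.sum_le_sum fun b _ => by have := le_max_left (-V a b) 0; linarith
  -- `N ≤ X (W − massH) ≤ X (W + N)`, so `N ≤ X W / (1 − X) ≤ 2 X W`
  have h1 : N ≤ X * ((∑ x, ∑ y, V x y) / 2 + N) := by
    refine hneg.trans ?_
    exact mul_le_mul_of_nonneg_left (by linarith) hX0
  have h2 : N * (1 - X) ≤ X * ((∑ x, ∑ y, V x y) / 2) := by nlinarith
  have h3 : N ≤ 2 * X * ((∑ x, ∑ y, V x y) / 2) := by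
    have hN0 : 0 ≤ N := by
      rw [hN]; exact div_nonneg (Finset.sum_nonneg fun a _ => Finset.sum_nonneg fun b _ => le_max_right _ _) (by norm_num)
    nlinarith
  calc N ≤ 2 * X * ((∑ x, ∑ y, V x y) / 2) := h3
    _ = (2 * (k : ℝ) * ((k : ℝ) - 2) / ((m : ℝ) - k - 1)) * ((∑ x, ∑ y, V x y) / 2) := by rw [hXeq]; ring

/-! ## Entries of a minimal weighting -/

/-- **Positive entries of a tight set are bounded by its negative mass.** If `v(E(Q)) = 0` on a set `Q ∋ e` then
`v(e) ≤ ∑_{f ⊆ Q} max(−v(f), 0)`. [new; elementary] -/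
theorem entry_le_negMass_of_tight (v : Edge m → ℝ) {Q : Finset (Fin m)} (h0 : softWindow v Q = 0) {e : Edge m}
    (he : edgeVerts e ⊆ Q) :
    v e ≤ softWindow (fun f => max (-v f) 0) Q := by
  classical
  unfold softWindow at h0 ⊢
  set F : Finset (Edge m) := (Finset.univ : Finset (Edge m)).filter (fun f => edgeVerts f ⊆ Q) with hF
  have heF : e ∈ F := Finset.mem_filter.2 ⟨Finset.mem_univ _, he⟩
  have hsum : v e + ∑ f ∈ F.erase e, v f = 0 := by
    rw [Finset.add_sum_erase F v heF]; exact h0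
  have hrest : -∑ f ∈ F.erase e, v f ≤ ∑ f ∈ F.erase e, max (-v f) 0 := by
    rw [← Finset.sum_neg_distrib]
    exact Finset.sum_le_sum fun f _ => le_max_left _ _
  have hmono : ∑ f ∈ F.erase e, max (-v f) 0 ≤ ∑ f ∈ F, max (-v f) 0 :=
    Finset.sum_le_sum_of_subset_of_nonneg (Finset.erase_subset _ _) fun f _ _ => le_max_right _ _
  linarith

/-- **Entry bound `O(k²/m)` for minimal clique-non-negative weightings.** Let `4 ≤ k`, `2k² ≤ m`, and let `v` be a
`k`-clique-non-negative edge weighting of `K_m` in which every positive edge lies in a tight `k`-set (as produced by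
`…CliqueNonnegMinimal.exists_minimal_le`). Then every entry satisfies `|v(e)| ≤ (2k(k−2)/(m−k−1))·∑_f v(f)`. [new] -/
theorem abs_le_of_minimal {k : ℕ} (hk : 4 ≤ k) (hm : 2 * k ^ 2 ≤ m) (v : Edge m → ℝ)
    (hv : ∀ Q ∈ (Finset.univ : Finset (Fin m)).powersetCard k, 0 ≤ softWindow v Q)
    (htight : ∀ e, 0 < v e → ∃ Q ∈ (Finset.univ : Finset (Fin m)).powersetCard k, edgeVerts e ⊆ Q ∧ softWindow v Q = 0)
    (e : Edge m) :
    |v e| ≤ (2 * (k : ℝ) * ((k : ℝ) - 2) / ((m : ℝ) - k - 1)) * ∑ f, v f := by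
  classical
  have hkR : (4 : ℝ) ≤ k := by exact_mod_cast hk
  have hmR : 2 * (k : ℝ) ^ 2 ≤ m := by exact_mod_cast hm
  have hkk : k ≤ k ^ 2 := by nlinarith
  have hkm : k + 2 ≤ m := by nlinarith
  -- the symmetric matrix of `v`
  obtain ⟨V, hVdef⟩ : ∃ V : Fin m → Fin m → ℝ,
      V = fun x y => if h : x = y then 0 else v ⟨s(x, y), CliqueExtLowerBound.Negative.mk_mem_edgeSet_top h⟩ := ⟨_, rfl⟩
  have hV0 : ∀ x, V x x = 0 := fun x => by rw [hVdef]; simp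
  have hVoff : ∀ (x y : Fin m) (h : x ≠ y), V x y = v ⟨s(x, y), CliqueExtLowerBound.Negative.mk_mem_edgeSet_top h⟩ :=
    fun x y h => by rw [hVdef]; simp [h]
  have hVsym : ∀ x y, V x y = V y x := by
    intro x y
    by_cases h : x = y
    · rw [h]
    · rw [hVoff x y h, hVoff y x (Ne.symm h)]
      congr 1
      exact Subtype.ext Sym2.eq_swap
  have hvalidM : ∀ Q ∈ (Finset.univ : Finset (Fin m)).powersetCard k, 0 ≤ ∑ x ∈ Q, ∑ y ∈ Q, V x y := by
    intro Q hQ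
    have h := hv Q hQ
    rw [softWindow_eq_half_sum_sum v V hV0 hVoff Q] at h
    linarith
  have hmass : ∑ f, v f = (∑ x, ∑ y, V x y) / 2 := sum_edge_eq_half_sum_sum v V hV0 hVoff
  -- the negative-part weighting and its matrix
  have hNoff : ∀ (x y : Fin m) (h : x ≠ y), max (-V x y) 0 =
      (fun f => max (-v f) 0) ⟨s(x, y), CliqueExtLowerBound.Negative.mk_mem_edgeSet_top h⟩ := by
    intro x y h; simp only [hVoff x y h]
  have hN0 : ∀ x, max (-V x x) 0 = 0 := fun x => by rw [hV0, neg_zero, max_self]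
  -- the single-entry lower bound (dipole)
  have hW : 0 ≤ ∑ f, v f := by
    have h := abs_sum_le_of_cliqueNonneg_at hk hkm v hv
    have habs : 0 ≤ ∑ f, |v f| := Finset.sum_nonneg fun f _ => abs_nonneg _
    have hL : (0 : ℝ) < 2 * (k : ℝ) ^ 2 - 4 * k + 1 := by nlinarith
    by_contra hneg
    push Not at hneg
    have := mul_neg_of_pos_of_neg hL hneg
    linarith
  have hmk0 : (0 : ℝ) < (m : ℝ) - k := by
    have : ((k : ℝ) + 2 ≤ m) := by exact_mod_cast hkm
    linarith
  have hden : (0 : ℝ) < (m : ℝ) - k - 1 := by nlinarith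
  have hcoef : ((k : ℝ) - 2) / ((m : ℝ) - k) ≤ 2 * (k : ℝ) * ((k : ℝ) - 2) / ((m : ℝ) - k - 1) := by
    rw [div_le_div_iff₀ hmk0 hden]
    have h1 : (0 : ℝ) ≤ (k : ℝ) - 2 := by linarith
    have h2 : (0 : ℝ) ≤ 2 * (k : ℝ) * ((m : ℝ) - k) - ((m : ℝ) - k - 1) := by nlinarith
    nlinarith [mul_nonneg h1 h2]
  have hlow : -((2 * (k : ℝ) * ((k : ℝ) - 2) / ((m : ℝ) - k - 1)) * ∑ f, v f) ≤ v e := by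
    have h := neg_entry_le_of_cliqueNonneg_at hk hkm v hv e
    have := mul_le_mul_of_nonneg_right hcoef hW
    linarith
  rw [abs_le]
  refine ⟨hlow, ?_⟩
  by_cases hpos : 0 < v e
  · obtain ⟨Q, hQ, heQ, h0⟩ := htight e hpos
    have hQk : Q.card = k := (Finset.mem_powersetCard.1 hQ).2
    have h1 := entry_le_negMass_of_tight v h0 heQ
    rw [softWindow_eq_half_sum_sum (fun f => max (-v f) 0) (fun x y => max (-V x y) 0) hN0 hNoff Q] at h1
    have h2 := negMass_kset_le hk hm V hVsym hV0 hvalidM Q hQk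
    rw [← hmass] at h2
    exact h1.trans h2
  · push Not at hpos
    exact hpos.trans (mul_nonneg (div_nonneg (by nlinarith) hden.le) hW)

/-- **Entry bound `O(k²/m)` for minimal clique-non-negative weightings** (registered form of `abs_le_of_minimal`). [new] -/
theorem minimal_entry_bound : ∀ {m k : ℕ}, 4 ≤ k → 2 * k ^ 2 ≤ m → ∀ (v : Edge m → ℝ), (∀ Q ∈ (Finset.univ : Finset (Fin m)).powersetCard k, 0 ≤ softWindow v Q) → (∀ e, 0 < v e → ∃ Q ∈ (Finset.univ : Finset (Fin m)).powersetCard k, edgeVerts e ⊆ Q ∧ softWindow v Q = 0) → ∀ (e : Edge m), |v e| ≤ (2 * (k : ℝ) * ((k : ℝ) - 2) / ((m : ℝ) - k - 1)) * ∑ f, v f :=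
  fun hk hm v hv htight e => abs_le_of_minimal hk hm v hv htight e

end

end Summit.PneNP.PneNP.Theorems
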